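import Summits.QuantumFields.BalabanUV.T4Continuum.Spine.NE3.NestedMeanCompetitorCurved
import Summits.QuantumFields.BalabanUV.T4Continuum.Spine.NE3.PairLandauB8EndSfClassH3sup
import Summits.QuantumFields.BalabanUV.T4Continuum.Spine.NE3.TangentProjectionSlicB8Class
import HarnessLib

/-!
# T⁴ programme, node NE3 — census R45: THE END ON B8's SURFACE OVER `sfClass` WITH THE [B9]-§3-TYPE BINDER `hP` GONE — NE3's local half over Bałaban's class
# ⇐ `PairLandauGaugeB8Avg` ([B8] Thm 2 + (1.37) ∘ [B11] Thm 1 TYPE) ∧ (H3ˢᵘᵖ) ([B11] Thm 1 (8)+(10) TYPE) ∧ FOUR k-FREE NUMERIC LINES of the owner swarm — nothing else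

Cell `pub-balaban-gaps` (track G2, seat `ne3`, unit `pub-balaban-gaps-ne3-g10`; writer prover-pub-balaban-gaps-ne3-g10-0, 2026-08-25), census `ne/NE3.md` §4 R45 ∕ §16.
WHY.  THE END of record with the sup letter gone, `PairLandauB8EndSfClassH3sup.ne3EnergyRateWCov_sfClass_small_of_leafH3sup` (gen 9), still displays per pair
`hP : IsMinimiser … (j+2) V U_B → Regular … U_B → SlicePoincare L (j+1) (cavg L U_B) (slicB8 L N (j+1) (cavg L U_B)) CP (periodBox (N·L^{j+1}))` — the (P♮) TYPE of
[Balaban1985BackgroundPropagators] Thm 3.3.  Gen 10 PROVED it: the owner swarm's curved (P♮) on `T_♮(W)` (`NE3ClassSlicePoincare`) ∘ R42 (`AvgKernelGaugeDecomposition`,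
`SlicePoincareCoulombN`) ∘ R43 (`SlicePoincareSlicB8Reduction`) ∘ R44 (`NestedMeanSmoothInterpolant`, `NestedMeanCompetitorCurved.slicePoincare_slicB8_sfClass_of_lines`).
THIS FILE plugs it in:
* §1 **`slicePoincare_slicB8_cavg_of_regular`** — the binder `hP` LITERALLY: for every `(b, g)`-regular run-B configuration `U_B` at level `j+2` (the two rescaling lines
  `hbs`∕`hbε′` of `MinimalActionRate.rescale_bavg_mem_sfClass`, the two class-radius family lines of `TangentProjectionSlicB8Class.levelSmall_family_background`, the owner's four
  lines, the absorption line), `SlicePoincare L (j+1) (cavg L U_B) (slicB8 …) CP* (periodBox (N·L^{j+1}))` with the k-FREE `CP* = 4·card n·(69 + 2δ)·CPLine d L (card n) εc θ`.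
* §3 **`ne3EnergyRateWCov_sfClass_small_SU2`** ∕ **`_SU3`** — at `d = 4`, `L = 2`, SU(2)∕SU(3) the four lines hold at `θ = 10⁻⁵³`, `εc = 10⁻¹⁷` (the owner's
  `lines_d4_L2_c2∕c3`), so THE END carries NO slice-Poincaré hypothesis and NO `(θ, εc)` line at all.
* §4 **`ownerLines_exist`** (the owner's four lines are satisfiable for EVERY `(d, L, card n)`: continuity at `θ = 0` with `εc := 1∕(200 + 700·bhTop(0))`) and
  **`ne3EnergyRateWCov_sfClass_small_lineFree`** — THE END for every `(d, L, n)` with NO numeric line but the two leaf lines on `(b′, c′)`.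
* §2 **`ne3EnergyRateWCov_sfClass_small_of_leafH3sup_of_lines`** — THE END WITH `hP` GONE: for every `θ > 0`, `εc > 0` satisfying the owner's four k-free lines there is `r > 0` such
  that for all `0 < ε ≤ r`, `0 ≤ s₁ ≤ r`, `0 ≤ b ≤ ε∕2`: `PairLandauGaugeB8Avg d (sfClass d L N ε) L N b g s₁ s₂ 1 dom` ∧ `LeafH3sup d L N ε b′ c′ dom` ⟹
  `∃ C, NE3EnergyRateWCov d (sfClass d L N ε) L N b g C s₁ s₂ dom` (the ε-lines — absorption, family, rescaling — are absorbed into `r`).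

HONEST FRAMING.  Bookkeeping over landed theorems BY NAME; the remaining per-pair hypotheses of THE END are `PairLandauGaugeB8Avg` ([B8] Thm 2 + (1.37) ∘ [B11] Thm 1 TYPE,
unproved) and (H3ˢᵘᵖ) ([B11] Thm 1 (8)+(10) TYPE, unproved) — plus the Π-REG majorant inside `…_B8` where displayed; the four lines on `(θ, εc)` are the owner's
(`NE3ClassSlicePoincare`, numerically certified at d = 4, L = 2, SU(2)∕SU(3)); nothing of Bałaban's asserted; the covariant root and **NE3 are NOT proved**; spine PROVED 0∕9;
finite T⁴ rung (B)+1 — NOT continuum YM on ℝ⁴, NOT infinite volume, NOT mass gap, NOT Clay.  PLACEMENT: `Summits/QuantumFields/BalabanUV/T4Continuum/Spine/NE3/`.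
-/

set_option autoImplicit false

open scoped BigOperators Matrix Matrix.Norms.L2Operator
open Finset

namespace Summit.QuantumFields.BalabanUV.T4Continuum.NE3.PairLandauB8EndSfClassHP

open Literature.MathematicalPhysics.QuantumFieldTheory.Balaban1983to89
open B7Prop1Explicit B7Prop2Explicit
open T4AveragingDeficitWall (IsUnitaryCfg IsSkewDir SmallField Plane)
open T4AveragingDeficitWallBoundary (IsPeriodicCfg periodBox)
open AveragingDeficitChartCalculus (cavg)
open AveragingDeficitTwoLevelPrep (twoLevelSmall)
open AveragingDeficitMultiLevelPrep (LevelSmall)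
open MinimalActionSandwich (IsMinimiser)
open MinimalActionRate (Regular sfClass rescale_bavg_mem_sfClass)
open BlockAverageCurrent (curConst)
open NE3EnergyWeightedCovShape (NE3EnergyRateWCov)
open NE3SlicePoincareShape (SlicePoincare)
open NE3RightInverseSupLetters (frameC)
open NE3SlicePoincareBudgetLine (CPLine ShLine SmallYLine)
open NE3CovariantLineSumsL2 (C2sq)
open NE3CovariantLineSumsL2Tower (rho)
open NE3.PairLandauB8Avg (PairLandauGaugeB8Avg slicB8)
open NE3.LeafIndexSockets (LeafH3sup)
open NE3.PairLandauB8EndSfClassH3sup (ne3EnergyRateWCov_sfClass_small_of_leafH3sup)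
open NE3.TangentProjectionSlicB8Class (levelSmall_family_background)
open NE3.SlicePoincareCoulombN (CPLine_nonneg)
open NE3.NestedMeanCompetitorCurved (slicePoincare_slicB8_sfClass_of_lines)

noncomputable section

variable {d : ℕ} {n : Type*} [Fintype n] [DecidableEq n]

/-! ## §1 The binder `hP`, literally -/

/-- **THE END's BINDER `hP`, LITERALLY** (`3 ≤ d`, `2 ≤ L`, `1 ≤ N`; `0 ≤ b`, `0 < ε ≤ θ`, `0 < εc`; rescaling lines `hbs`, `hbε′`; class-radius family lines `hf1`, `hf2`; the owner's
four lines; the absorption line): for every `(b, g)`-regular `U_B` at level `j+2`,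
`SlicePoincare L (j+1) (cavg L U_B) (slicB8 L N (j+1) (cavg L U_B)) (4·card n·(69 + 2δ)·CPLine d L (card n) εc θ) (periodBox (N·L^{j+1}))`. [folklore] -/
theorem slicePoincare_slicB8_cavg_of_regular [Nonempty n] (hd : 3 ≤ d) {L N : ℕ} (hL : 2 ≤ L) (hN : 1 ≤ N) {ε θ εc b g : ℝ}
    (hb : 0 ≤ b) (hε : 0 < ε) (hεθ : ε ≤ θ) (hεc : 0 < εc)
    (hbs : 512 * (d + 1) * (d + 4) * (L : ℝ) ^ 2 * b ≤ 1) (hbε' : b + 226 * (8 * (d + 1) * (d + 4)) ^ 2 * b ^ 2 ≤ ε)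
    (hf1 : 16 * (14464 * ((d : ℝ) + 1) ^ 2 * ((d : ℝ) + 4) ^ 2) * ε ≤ 3) (hf2 : 2 * twoLevelSmall d L * ε ≤ (L : ℝ) ^ 2)
    (h1 : ShLine d L (Fintype.card n) εc θ ≤ 1 / 2) (h2 : SmallYLine d L (Fintype.card n) εc θ ≤ 1 / 2)
    (h3 : 68 / 3 * (((d : ℝ) + 1) * ((d : ℝ) + 4)) * C2sq d L * θ ≤ rho d L / 2)
    (h4 : 8 * d * (((d : ℝ) - 1) * θ) ^ 2
      + 2 * ((Fintype.card n : ℝ) * ((4 * (d : ℝ) ^ 2 + 272 * d * (((d : ℝ) + 1) * ((d : ℝ) + 4))) * θ) ^ 2) ≤ 1 / 2)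
    (h6 : 128 * (69 + 2 * ((2 + 32 * (8 * (Fintype.card n : ℝ) * d * (1 + 2 * (((d : ℝ) - 1) * θ)) ^ 2 * (2 * (8 : ℝ) ^ d) ^ 2))
              * (8 * (Fintype.card n : ℝ) * d * (1 + 2 * (((d : ℝ) - 1) * θ)) ^ 2 * (2 * (8 : ℝ) ^ d) ^ 2)))
        * CPLine d L (Fintype.card n) εc θ * (Fintype.card (Plane d) : ℝ) * (Fintype.card n : ℝ) * ε ^ 2 ≤ 1)
    (j : ℕ) {UB : Site d → Fin d → (Matrix n n ℂ)ˣ} (hreg : Regular d L N b g (j + 2) UB) :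
    SlicePoincare L (j + 1) (cavg L UB) (slicB8 (d := d) (n := n) L N (j + 1) (cavg L UB))
      (4 * (Fintype.card n : ℝ) * (69 + 2 * ((2 + 32 * (8 * (Fintype.card n : ℝ) * d * (1 + 2 * (((d : ℝ) - 1) * θ)) ^ 2 * (2 * (8 : ℝ) ^ d) ^ 2))
              * (8 * (Fintype.card n : ℝ) * d * (1 + 2 * (((d : ℝ) - 1) * θ)) ^ 2 * (2 * (8 : ℝ) ^ d) ^ 2))) * CPLine d L (Fintype.card n) εc θ)
      (periodBox (d := d) (N * L ^ (j + 1))) := by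
  have hL1 : 1 ≤ L := by omega
  have hcl : cavg L UB ∈ sfClass d L N ε (j + 1) := rescale_bavg_mem_sfClass hL1 hb hbs hbε' hreg
  have hfam : ∀ i : ℕ, LevelSmall d L (i + 1) (ε / ((L : ℝ) ^ (i + 2)) ^ 2) := fun i =>
    levelSmall_family_background hL hε.le hf1 hf2 (i + 1)
  exact slicePoincare_slicB8_sfClass_of_lines hd hL hN hε hεθ hεc hfam h1 h2 h3 h4 h6 j (cavg L UB) hcl

/-! ## §2 THE END with `hP` gone -/

set_option maxHeartbeats 800000 in
/-- **NE3's LOCAL HALF OVER BAŁABAN's CLASS WITH THE SUP LETTER AND THE SLICE-POINCARÉ BINDER GONE** (`3 ≤ d`, `2 ≤ L`, `1 ≤ N`, `g > 0`; leaf letters `0 ≤ b′, c′` on the two lines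
(Rb) `2^15(d+1)²(d+4)²L²b′ ≤ 1`, `23040d⁴(frameC+d)³(c′ + curConst·b′²) ≤ 1`; the owner swarm's four k-free lines on `(θ, εc)`, `θ, εc > 0`): there is `r > 0` such that for all
`0 < ε ≤ r`, `0 ≤ s₁ ≤ r`, `0 ≤ b ≤ ε∕2`: `PairLandauGaugeB8Avg d (sfClass d L N ε) L N b g s₁ s₂ 1 dom` ([B8] Thm 2 + (1.37) ∘ [B11] Thm 1 TYPE) ∧ `LeafH3sup d L N ε b′ c′ dom`
([B11] Thm 1 (8)+(10) TYPE) ⟹ `∃ C, NE3EnergyRateWCov d (sfClass d L N ε) L N b g C s₁ s₂ dom`.  Compared with gen 9's `ne3EnergyRateWCov_sfClass_small_of_leafH3sup` the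
per-pair binder `hP` ((P♮) on `slicB8`, [B9] Thm 3.3 TYPE) is GONE — proved (gen 10, R42–R44 over the owner swarm's `NE3SlicePoincareCurved`). [folklore] -/
theorem ne3EnergyRateWCov_sfClass_small_of_leafH3sup_of_lines [Nonempty n] (hd : 3 ≤ d) {L N : ℕ} [NeZero L] [NeZero N] (hL : 2 ≤ L) (hN : 1 ≤ N)
    {g b' c' θ εc : ℝ} (hg : 0 < g) (hb' : 0 ≤ b') (hc' : 0 ≤ c') (hθ : 0 < θ) (hεc : 0 < εc)
    (hRb : 2 ^ 15 * ((d : ℝ) + 1) ^ 2 * ((d : ℝ) + 4) ^ 2 * (L : ℝ) ^ 2 * b' ≤ 1)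
    (hcF : 23040 * (d : ℝ) ^ 4 * (frameC d L + d) ^ 3 * (c' + curConst d L * b' ^ 2) ≤ 1)
    (h1 : ShLine d L (Fintype.card n) εc θ ≤ 1 / 2) (h2 : SmallYLine d L (Fintype.card n) εc θ ≤ 1 / 2)
    (h3 : 68 / 3 * (((d : ℝ) + 1) * ((d : ℝ) + 4)) * C2sq d L * θ ≤ rho d L / 2)
    (h4 : 8 * d * (((d : ℝ) - 1) * θ) ^ 2
      + 2 * ((Fintype.card n : ℝ) * ((4 * (d : ℝ) ^ 2 + 272 * d * (((d : ℝ) + 1) * ((d : ℝ) + 4))) * θ) ^ 2) ≤ 1 / 2) :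
    ∃ r : ℝ, 0 < r ∧ ∀ ⦃ε s₁ b : ℝ⦄, 0 < ε → ε ≤ r → 0 ≤ s₁ → s₁ ≤ r → 0 ≤ b → b ≤ ε / 2 →
      ∀ (s₂ : ℝ) {dom : _root_.Set (Site d → Fin d → (Matrix n n ℂ)ˣ)},
        PairLandauGaugeB8Avg d (sfClass d L N ε) L N b g s₁ s₂ 1 dom →
        LeafH3sup d L N ε b' c' dom →
        ∃ C : ℝ, NE3EnergyRateWCov d (sfClass d L N ε) L N b g C s₁ s₂ dom := by
  have hd1 : 1 ≤ d := by omega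
  have hd0 : (0 : ℝ) < d := by exact_mod_cast (show 0 < d by omega)
  have hL0 : (0 : ℝ) < L := by exact_mod_cast (show 0 < L by omega)
  have hd1r : (1 : ℝ) ≤ d := by exact_mod_cast hd1
  have hdm : (0 : ℝ) ≤ (d : ℝ) - 1 := by linarith
  -- the k-free slice constant
  obtain ⟨δW, hδW⟩ : ∃ D : ℝ, D = (2 + 32 * (8 * (Fintype.card n : ℝ) * d * (1 + 2 * (((d : ℝ) - 1) * θ)) ^ 2 * (2 * (8 : ℝ) ^ d) ^ 2))
      * (8 * (Fintype.card n : ℝ) * d * (1 + 2 * (((d : ℝ) - 1) * θ)) ^ 2 * (2 * (8 : ℝ) ^ d) ^ 2) := ⟨_, rfl⟩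
  have hδW0 : 0 ≤ δW := by
    rw [hδW]
    have : 0 ≤ 1 + 2 * (((d : ℝ) - 1) * θ) := by have := mul_nonneg hdm hθ.le; linarith
    positivity
  have hCPL : 0 ≤ CPLine d L (Fintype.card n) εc θ := CPLine_nonneg hd1 L (by positivity) hεc.le hθ.le
  obtain ⟨CP, hCP⟩ : ∃ C : ℝ, C = 4 * (Fintype.card n : ℝ) * (69 + 2 * δW) * CPLine d L (Fintype.card n) εc θ := ⟨_, rfl⟩
  have hCP0 : 0 ≤ CP := by rw [hCP]; positivity
  obtain ⟨r, hr0, hr⟩ := ne3EnergyRateWCov_sfClass_small_of_leafH3sup (n := n) hd hL hN hg hCP0 hb' hc' hRb hcF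
  -- the ε-radii of the lines absorbed into `r`
  obtain ⟨A, hA⟩ : ∃ A : ℝ, A = 128 * (69 + 2 * δW) * CPLine d L (Fintype.card n) εc θ * (Fintype.card (Plane d) : ℝ) * (Fintype.card n : ℝ) := ⟨_, rfl⟩
  have hA0 : 0 ≤ A := by rw [hA]; positivity
  obtain ⟨B₁, hB₁⟩ : ∃ B : ℝ, B = 16 * (14464 * ((d : ℝ) + 1) ^ 2 * ((d : ℝ) + 4) ^ 2) := ⟨_, rfl⟩
  have hB₁0 : 0 < B₁ := by rw [hB₁]; positivity
  obtain ⟨B₂, hB₂⟩ : ∃ B : ℝ, B = 2 * twoLevelSmall d L := ⟨_, rfl⟩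
  have hB₂0 : 0 < B₂ := by rw [hB₂]; unfold twoLevelSmall; positivity
  obtain ⟨B₃, hB₃⟩ : ∃ B : ℝ, B = 512 * ((d : ℝ) + 1) * ((d : ℝ) + 4) * (L : ℝ) ^ 2 := ⟨_, rfl⟩
  have hB₃0 : 0 < B₃ := by rw [hB₃]; positivity
  obtain ⟨B₄, hB₄⟩ : ∃ B : ℝ, B = 226 * (8 * ((d : ℝ) + 1) * ((d : ℝ) + 4)) ^ 2 := ⟨_, rfl⟩
  have hB₄0 : 0 < B₄ := by rw [hB₄]; positivity
  have hL2 : (0 : ℝ) < (L : ℝ) ^ 2 := by positivity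
  refine ⟨min r (min θ (min (1 / (A + 1)) (min (3 / B₁) (min ((L : ℝ) ^ 2 / B₂) (min (1 / B₃) (2 / B₄)))))),
    lt_min hr0 (lt_min hθ (lt_min (by positivity) (lt_min (by positivity) (lt_min (by positivity) (lt_min (by positivity) (by positivity)))))),
    fun ε s₁ b hε hεr hs₁ hs₁r hb hbh s₂ dom hB8 h3L => ?_⟩
  have hεr' : ε ≤ r := hεr.trans (min_le_left _ _)
  have hεθ : ε ≤ θ := hεr.trans ((min_le_right _ _).trans (min_le_left _ _))
  have hεA : ε ≤ 1 / (A + 1) := hεr.trans ((min_le_right _ _).trans ((min_le_right _ _).trans (min_le_left _ _)))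
  have hε1 : ε ≤ 3 / B₁ := hεr.trans ((min_le_right _ _).trans ((min_le_right _ _).trans ((min_le_right _ _).trans (min_le_left _ _))))
  have hε2 : ε ≤ (L : ℝ) ^ 2 / B₂ :=
    hεr.trans ((min_le_right _ _).trans ((min_le_right _ _).trans ((min_le_right _ _).trans ((min_le_right _ _).trans (min_le_left _ _)))))
  have hε3 : ε ≤ 1 / B₃ :=
    hεr.trans ((min_le_right _ _).trans ((min_le_right _ _).trans ((min_le_right _ _).trans ((min_le_right _ _).trans ((min_le_right _ _).trans (min_le_left _ _))))))
  have hε4 : ε ≤ 2 / B₄ :=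
    hεr.trans ((min_le_right _ _).trans ((min_le_right _ _).trans ((min_le_right _ _).trans ((min_le_right _ _).trans ((min_le_right _ _).trans (min_le_right _ _))))))
  have hs₁r' : s₁ ≤ r := hs₁r.trans (min_le_left _ _)
  -- the lines at this `ε`
  have hf1 : 16 * (14464 * ((d : ℝ) + 1) ^ 2 * ((d : ℝ) + 4) ^ 2) * ε ≤ 3 := by
    rw [← hB₁]; rw [le_div_iff₀ hB₁0] at hε1; linarith
  have hf2 : 2 * twoLevelSmall d L * ε ≤ (L : ℝ) ^ 2 := by
    rw [← hB₂]; rw [le_div_iff₀ hB₂0] at hε2; linarith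
  have hbs : 512 * (d + 1) * (d + 4) * (L : ℝ) ^ 2 * b ≤ 1 := by
    have h1' : B₃ * ε ≤ 1 := by rw [le_div_iff₀ hB₃0] at hε3; linarith
    have : B₃ * b ≤ B₃ * ε := mul_le_mul_of_nonneg_left (by linarith) hB₃0.le
    rw [hB₃] at this h1'
    linarith
  have hbε' : b + 226 * (8 * (d + 1) * (d + 4)) ^ 2 * b ^ 2 ≤ ε := by
    have hB4ε : B₄ * ε ≤ 2 := by rw [le_div_iff₀ hB₄0] at hε4; linarith
    have hb2 : b ^ 2 ≤ (ε / 2) ^ 2 := pow_le_pow_left₀ hb hbh 2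
    have : B₄ * b ^ 2 ≤ ε / 2 := by
      calc B₄ * b ^ 2 ≤ B₄ * (ε / 2) ^ 2 := mul_le_mul_of_nonneg_left hb2 hB₄0.le
        _ = (B₄ * ε) * ε / 4 := by ring
        _ ≤ 2 * ε / 4 := by
            have := mul_le_mul_of_nonneg_right hB4ε hε.le
            linarith
        _ = ε / 2 := by ring
    rw [hB₄] at this
    linarith
  have h6 : 128 * (69 + 2 * ((2 + 32 * (8 * (Fintype.card n : ℝ) * d * (1 + 2 * (((d : ℝ) - 1) * θ)) ^ 2 * (2 * (8 : ℝ) ^ d) ^ 2))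
              * (8 * (Fintype.card n : ℝ) * d * (1 + 2 * (((d : ℝ) - 1) * θ)) ^ 2 * (2 * (8 : ℝ) ^ d) ^ 2)))
        * CPLine d L (Fintype.card n) εc θ * (Fintype.card (Plane d) : ℝ) * (Fintype.card n : ℝ) * ε ^ 2 ≤ 1 := by
    rw [← hδW, ← hA]
    have hA1 : 0 < A + 1 := by linarith
    have hεA' : ε * (A + 1) ≤ 1 := by rwa [le_div_iff₀ hA1] at hεA
    have hε1' : ε ≤ 1 := by
      have : ε ≤ ε * (A + 1) := le_mul_of_one_le_right hε.le (by linarith)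
      linarith
    have t1 : A * ε * ε ≤ A * ε * 1 := mul_le_mul_of_nonneg_left hε1' (by positivity)
    have t2 : A * ε ≤ ε * (A + 1) := by linarith [hε.le]
    calc A * ε ^ 2 = A * ε * ε := by ring
      _ ≤ A * ε * 1 := t1
      _ = A * ε := by ring
      _ ≤ ε * (A + 1) := t2
      _ ≤ 1 := hεA'
  refine hr hε hεr' hs₁ hs₁r' hb hbh s₂ hB8 h3L ?_
  intro j V _ UB _ hreg
  have hP := slicePoincare_slicB8_cavg_of_regular hd hL hN hb hε hεθ hεc hbs hbε' hf1 hf2 h1 h2 h3 h4 h6 j hreg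
  rw [← hδW, ← hCP] at hP
  exact hP

/-! ## §3 At `d = 4`, `L = 2`, SU(2): THE END with NO slice-Poincaré hypothesis and NO line on `(θ, εc)` -/

/-- **NE3's LOCAL HALF OVER BAŁABAN's CLASS AT `d = 4`, `L = 2`, `card n = 2` — [B8] Thm 2 ∘ [B11] Thm 1 TYPE ∧ (H3ˢᵘᵖ) TYPE ∧ the two leaf lines ONLY** (`g > 0`, `N ≥ 1`,
`0 ≤ b′, c′`, (Rb) `2^15·5²·8²·2²·b′ ≤ 1`, `23040·4⁴(frameC+4)³(c′ + curConst·b′²) ≤ 1`): there is `r > 0` such that for all `0 < ε ≤ r`, `0 ≤ s₁ ≤ r`, `0 ≤ b ≤ ε∕2`: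
`PairLandauGaugeB8Avg 4 (sfClass 4 2 N ε) 2 N b g s₁ s₂ 1 dom` ∧ `LeafH3sup 4 2 N ε b′ c′ dom` ⟹ `∃ C, NE3EnergyRateWCov 4 (sfClass 4 2 N ε) 2 N b g C s₁ s₂ dom` — the owner's four
lines hold at `θ = 10⁻⁵³`, `εc = 10⁻¹⁷` (`NE3ClassSlicePoincare.lines_d4_L2_c2`). [folklore] -/
theorem ne3EnergyRateWCov_sfClass_small_SU2 [Nonempty n] (hn : Fintype.card n = 2) {N : ℕ} [NeZero N] (hN : 1 ≤ N)
    {g b' c' : ℝ} (hg : 0 < g) (hb' : 0 ≤ b') (hc' : 0 ≤ c')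
    (hRb : 2 ^ 15 * (((4 : ℕ) : ℝ) + 1) ^ 2 * (((4 : ℕ) : ℝ) + 4) ^ 2 * ((2 : ℕ) : ℝ) ^ 2 * b' ≤ 1)
    (hcF : 23040 * ((4 : ℕ) : ℝ) ^ 4 * (frameC 4 2 + (4 : ℕ)) ^ 3 * (c' + curConst 4 2 * b' ^ 2) ≤ 1) :
    ∃ r : ℝ, 0 < r ∧ ∀ ⦃ε s₁ b : ℝ⦄, 0 < ε → ε ≤ r → 0 ≤ s₁ → s₁ ≤ r → 0 ≤ b → b ≤ ε / 2 →
      ∀ (s₂ : ℝ) {dom : _root_.Set (Site 4 → Fin 4 → (Matrix n n ℂ)ˣ)},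
        PairLandauGaugeB8Avg 4 (sfClass 4 2 N ε) 2 N b g s₁ s₂ 1 dom →
        LeafH3sup 4 2 N ε b' c' dom →
        ∃ C : ℝ, NE3EnergyRateWCov 4 (sfClass 4 2 N ε) 2 N b g C s₁ s₂ dom := by
  haveI : NeZero (2 : ℕ) := ⟨by norm_num⟩
  obtain ⟨h1, h2, h3, h4, -⟩ := NE3ClassSlicePoincare.lines_d4_L2_c2
  have h := ne3EnergyRateWCov_sfClass_small_of_leafH3sup_of_lines (n := n) (d := 4) (L := 2) (N := N) (by norm_num) (by norm_num) hN
    (θ := 1 / 10 ^ 53) (εc := 1 / 10 ^ 17) hg hb' hc' (by norm_num) (by norm_num) hRb hcF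
  rw [hn] at h
  exact h h1 h2 h3 h4

/-- **THE SAME AT `card n = 3`** (SU(3); `NE3ClassSlicePoincare.lines_d4_L2_c3`). [folklore] -/
theorem ne3EnergyRateWCov_sfClass_small_SU3 [Nonempty n] (hn : Fintype.card n = 3) {N : ℕ} [NeZero N] (hN : 1 ≤ N)
    {g b' c' : ℝ} (hg : 0 < g) (hb' : 0 ≤ b') (hc' : 0 ≤ c')
    (hRb : 2 ^ 15 * (((4 : ℕ) : ℝ) + 1) ^ 2 * (((4 : ℕ) : ℝ) + 4) ^ 2 * ((2 : ℕ) : ℝ) ^ 2 * b' ≤ 1)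
    (hcF : 23040 * ((4 : ℕ) : ℝ) ^ 4 * (frameC 4 2 + (4 : ℕ)) ^ 3 * (c' + curConst 4 2 * b' ^ 2) ≤ 1) :
    ∃ r : ℝ, 0 < r ∧ ∀ ⦃ε s₁ b : ℝ⦄, 0 < ε → ε ≤ r → 0 ≤ s₁ → s₁ ≤ r → 0 ≤ b → b ≤ ε / 2 →
      ∀ (s₂ : ℝ) {dom : _root_.Set (Site 4 → Fin 4 → (Matrix n n ℂ)ˣ)},
        PairLandauGaugeB8Avg 4 (sfClass 4 2 N ε) 2 N b g s₁ s₂ 1 dom →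
        LeafH3sup 4 2 N ε b' c' dom →
        ∃ C : ℝ, NE3EnergyRateWCov 4 (sfClass 4 2 N ε) 2 N b g C s₁ s₂ dom := by
  haveI : NeZero (2 : ℕ) := ⟨by norm_num⟩
  obtain ⟨hC, hρ⟩ := NE3ClassSlicePoincare.C2sq_four_two
  obtain ⟨h1, h2, h4, -⟩ := NE3ClassSlicePoincare.lines_d4_L2_c3
  have h3 : 68 / 3 * ((((4 : ℕ) : ℝ) + 1) * (((4 : ℕ) : ℝ) + 4)) * C2sq 4 2 * (1 / 10 ^ 53) ≤ rho 4 2 / 2 := by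
    rw [hC, hρ]; norm_num
  have h := ne3EnergyRateWCov_sfClass_small_of_leafH3sup_of_lines (n := n) (d := 4) (L := 2) (N := N) (by norm_num) (by norm_num) hN
    (θ := 1 / 10 ^ 53) (εc := 1 / 10 ^ 17) hg hb' hc' (by norm_num) (by norm_num) hRb hcF
  rw [hn] at h
  exact h h1 h2 h3 h4

/-! ## §4 The owner's four lines are satisfiable for EVERY `(d, L, card n)`; THE END with no numeric line but the two leaf lines -/

/-- **THE OWNER SWARM's FOUR k-FREE LINES ARE JOINTLY SATISFIABLE** for every `d`, `L ≥ 1` and `c ≥ 0` (G4-style non-vacuity): at `θ = 0` the four left-hand sides are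
`1∕4`, `2(1 + (1+8εc)·2·bhTop(0))·(24εc + 18¼εc²) + 9εc`, `0`, `0` (`simp`), the second is `< ½` for `εc := 1∕(200 + 700·bhTop(0))`, and all four are continuous in `θ`. [folklore] -/
theorem ownerLines_exist (d : ℕ) {L : ℕ} (hL : 1 ≤ L) {c : ℝ} (hc : 0 ≤ c) :
    ∃ θ εc : ℝ, 0 < θ ∧ 0 < εc ∧ ShLine d L c εc θ ≤ 1 / 2 ∧ SmallYLine d L c εc θ ≤ 1 / 2 ∧
      68 / 3 * (((d : ℝ) + 1) * ((d : ℝ) + 4)) * C2sq d L * θ ≤ rho d L / 2 ∧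
      8 * d * (((d : ℝ) - 1) * θ) ^ 2 + 2 * (c * ((4 * (d : ℝ) ^ 2 + 272 * d * (((d : ℝ) + 1) * ((d : ℝ) + 4))) * θ) ^ 2) ≤ 1 / 2 := by
  -- the K1 cut `εc`
  obtain ⟨B₀, hB₀⟩ : ∃ B : ℝ, B = NE3SlicePoincareBudgetLine.bhTop d L c 0 := ⟨_, rfl⟩
  have hB₀0 : 0 ≤ B₀ := by
    rw [hB₀]
    simp only [NE3SlicePoincareBudgetLine.bhTop, NE3SlicePoincareBudgetLine.wTop, NE3SlicePoincareBudgetLine.qTop,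
      NE3SlicePoincareBudgetLine.lrTop, mul_zero, add_zero]
    positivity
  obtain ⟨εc, hεc⟩ : ∃ e : ℝ, e = 1 / (200 + 700 * B₀) := ⟨_, rfl⟩
  have hden : 0 < 200 + 700 * B₀ := by positivity
  have hεc0 : 0 < εc := by rw [hεc]; positivity
  have hεc1 : εc * (200 + 700 * B₀) = 1 := by rw [hεc]; field_simp
  have hεc2 : εc ≤ 1 / 200 := by rw [hεc]; exact one_div_le_one_div_of_le (by norm_num) (by linarith [mul_nonneg (by norm_num : (0:ℝ) ≤ 700) hB₀0])
  -- the values at `θ = 0`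
  have hSy : NE3SlicePoincareBudgetLine.SyLine d L c εc 0 = 24 * εc + (18 + 1 / 4) * εc ^ 2 := by
    simp [NE3SlicePoincareBudgetLine.SyLine, NE3SlicePoincareBudgetLine.kTop, NE3SlicePoincareBudgetLine.cjTop, NE3SlicePoincareBudgetLine.lrTop,
      NE3SlicePoincareBudgetLine.sTop, NE3SlicePoincareBudgetLine.cfTop, NE3SlicePoincareBudgetLine.ALine]
  have hKh : NE3SlicePoincareBudgetLine.KhLine d L c εc 0 = 1 + (1 + 8 * εc) * 2 * B₀ := by
    rw [hB₀]; simp [NE3SlicePoincareBudgetLine.KhLine, NE3SlicePoincareBudgetLine.gTop, NE3SlicePoincareBudgetLine.cjTop, NE3SlicePoincareBudgetLine.lrTop]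
  have hs2 : NE3SlicePoincareBudgetLine.sTwoLine d L c εc 0 = 9 * εc := by
    simp [NE3SlicePoincareBudgetLine.sTwoLine, NE3SlicePoincareBudgetLine.gTop, NE3SlicePoincareBudgetLine.byTop, NE3SlicePoincareBudgetLine.gzTop,
      NE3SlicePoincareBudgetLine.cjTop, NE3SlicePoincareBudgetLine.lrTop, NE3SlicePoincareBudgetLine.dkTop, NE3SlicePoincareBudgetLine.pkTop,
      NE3SlicePoincareBudgetLine.sTop, NE3SlicePoincareBudgetLine.wTop]
  have hY0 : SmallYLine d L c εc 0 < 1 / 2 := by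
    rw [SmallYLine, hSy, hKh, hs2]
    have hEB : εc * B₀ ≤ 1 / 700 := by nlinarith [hεc1, hεc0, hB₀0]
    have h1 : 24 * εc + (18 + 1 / 4) * εc ^ 2 ≤ 25 * εc := by nlinarith [hεc2, hεc0]
    have h2 : 0 ≤ 24 * εc + (18 + 1 / 4) * εc ^ 2 := by positivity
    have h3 : 2 * (1 + (1 + 8 * εc) * 2 * B₀) ≤ 41 / 20 + 4 * B₀ := by nlinarith [hEB, hB₀0, hεc0]
    have h4 : 0 ≤ 2 * (1 + (1 + 8 * εc) * 2 * B₀) := by positivity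
    calc 2 * (1 + (1 + 8 * εc) * 2 * B₀) * (24 * εc + (18 + 1 / 4) * εc ^ 2) + 9 * εc
        ≤ (41 / 20 + 4 * B₀) * (25 * εc) + 9 * εc := by nlinarith [mul_le_mul h3 h1 h2 (by positivity)]
      _ = (1025 / 20 + 9) * εc + 100 * (εc * B₀) := by ring
      _ < 1 / 2 := by nlinarith [hεc2, hEB]
  have hSh0 : ShLine d L c εc 0 < 1 / 2 := by
    have : ShLine d L c εc 0 = 1 / 4 := by
      simp [ShLine, NE3SlicePoincareBudgetLine.ALine, NE3SlicePoincareBudgetLine.qTop, NE3SlicePoincareBudgetLine.cfTop, NE3SlicePoincareBudgetLine.lrTop]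
    rw [this]; norm_num
  -- continuity in `θ`
  have hcSh : Continuous fun θ : ℝ => ShLine d L c εc θ := by
    unfold ShLine NE3SlicePoincareBudgetLine.ALine NE3SlicePoincareBudgetLine.qTop NE3SlicePoincareBudgetLine.cfTop NE3SlicePoincareBudgetLine.lrTop
    fun_prop
  have hcY : Continuous fun θ : ℝ => SmallYLine d L c εc θ := by
    unfold SmallYLine NE3SlicePoincareBudgetLine.KhLine NE3SlicePoincareBudgetLine.SyLine NE3SlicePoincareBudgetLine.sTwoLine NE3SlicePoincareBudgetLine.gTop
      NE3SlicePoincareBudgetLine.bhTop NE3SlicePoincareBudgetLine.byTop NE3SlicePoincareBudgetLine.gzTop NE3SlicePoincareBudgetLine.kTop NE3SlicePoincareBudgetLine.dkTop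
      NE3SlicePoincareBudgetLine.pkTop NE3SlicePoincareBudgetLine.sTop NE3SlicePoincareBudgetLine.ALine NE3SlicePoincareBudgetLine.qTop NE3SlicePoincareBudgetLine.cfTop
      NE3SlicePoincareBudgetLine.cjTop NE3SlicePoincareBudgetLine.wTop NE3SlicePoincareBudgetLine.lrTop
    fun_prop
  have hc3 : Continuous fun θ : ℝ => 68 / 3 * (((d : ℝ) + 1) * ((d : ℝ) + 4)) * C2sq d L * θ := by fun_prop
  have hc4 : Continuous fun θ : ℝ => 8 * d * (((d : ℝ) - 1) * θ) ^ 2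
      + 2 * (c * ((4 * (d : ℝ) ^ 2 + 272 * d * (((d : ℝ) + 1) * ((d : ℝ) + 4))) * θ) ^ 2) := by fun_prop
  have hρ : 0 < rho d L / 2 := by
    have hL0 : (0 : ℝ) < L := by exact_mod_cast (show 0 < L by omega)
    unfold rho; positivity
  -- the four strict inequalities persist near `θ = 0`
  have hev : ∀ᶠ θ in nhds (0 : ℝ), ShLine d L c εc θ < 1 / 2 ∧ SmallYLine d L c εc θ < 1 / 2 ∧
      68 / 3 * (((d : ℝ) + 1) * ((d : ℝ) + 4)) * C2sq d L * θ < rho d L / 2 ∧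
      8 * d * (((d : ℝ) - 1) * θ) ^ 2 + 2 * (c * ((4 * (d : ℝ) ^ 2 + 272 * d * (((d : ℝ) + 1) * ((d : ℝ) + 4))) * θ) ^ 2) < 1 / 2 := by
    refine ((hcSh.continuousAt.eventually_lt continuousAt_const hSh0).and ((hcY.continuousAt.eventually_lt continuousAt_const hY0).and
      ((hc3.continuousAt.eventually_lt continuousAt_const ?_).and (hc4.continuousAt.eventually_lt continuousAt_const ?_))))
    · simpa using hρ
    · norm_num
  obtain ⟨δ, hδ, h⟩ := Metric.eventually_nhds_iff.mp hev
  have hθ : dist (δ / 2) (0 : ℝ) < δ := by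
    rw [Real.dist_eq, sub_zero, abs_of_pos (by positivity)]; linarith
  obtain ⟨a1, a2, a3, a4⟩ := h hθ
  exact ⟨δ / 2, εc, by positivity, hεc0, a1.le, a2.le, a3.le, a4.le⟩

/-- **NE3's LOCAL HALF OVER BAŁABAN's CLASS, EVERY `(d, L, n)`, WITH NO NUMERIC LINE BUT THE TWO LEAF LINES** (`3 ≤ d`, `2 ≤ L`, `1 ≤ N`, `g > 0`, `0 ≤ b′, c′`, (Rb), the leaf line on
`c′`): there is `r > 0` such that for all `0 < ε ≤ r`, `0 ≤ s₁ ≤ r`, `0 ≤ b ≤ ε∕2`: `PairLandauGaugeB8Avg d (sfClass d L N ε) L N b g s₁ s₂ 1 dom` ∧ `LeafH3sup d L N ε b′ c′ dom` ⟹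
`∃ C, NE3EnergyRateWCov d (sfClass d L N ε) L N b g C s₁ s₂ dom` — §2 with `(θ, εc)` from `ownerLines_exist`. [folklore] -/
theorem ne3EnergyRateWCov_sfClass_small_lineFree [Nonempty n] (hd : 3 ≤ d) {L N : ℕ} [NeZero L] [NeZero N] (hL : 2 ≤ L) (hN : 1 ≤ N)
    {g b' c' : ℝ} (hg : 0 < g) (hb' : 0 ≤ b') (hc' : 0 ≤ c')
    (hRb : 2 ^ 15 * ((d : ℝ) + 1) ^ 2 * ((d : ℝ) + 4) ^ 2 * (L : ℝ) ^ 2 * b' ≤ 1)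
    (hcF : 23040 * (d : ℝ) ^ 4 * (frameC d L + d) ^ 3 * (c' + curConst d L * b' ^ 2) ≤ 1) :
    ∃ r : ℝ, 0 < r ∧ ∀ ⦃ε s₁ b : ℝ⦄, 0 < ε → ε ≤ r → 0 ≤ s₁ → s₁ ≤ r → 0 ≤ b → b ≤ ε / 2 →
      ∀ (s₂ : ℝ) {dom : _root_.Set (Site d → Fin d → (Matrix n n ℂ)ˣ)},
        PairLandauGaugeB8Avg d (sfClass d L N ε) L N b g s₁ s₂ 1 dom →
        LeafH3sup d L N ε b' c' dom →
        ∃ C : ℝ, NE3EnergyRateWCov d (sfClass d L N ε) L N b g C s₁ s₂ dom := by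
  obtain ⟨θ, εc, hθ, hεc, h1, h2, h3, h4⟩ := ownerLines_exist d (L := L) (by omega) (c := (Fintype.card n : ℝ)) (by positivity)
  exact ne3EnergyRateWCov_sfClass_small_of_leafH3sup_of_lines hd hL hN hg hb' hc' hθ hεc hRb hcF h1 h2 h3 h4

end

end Summit.QuantumFields.BalabanUV.T4Continuum.NE3.PairLandauB8EndSfClassHP
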